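import Summits.BirchSwinnertonDyer.BirchSwinnertonDyer.Theses.KatoDescentTamePotSupersingular
import Summits.BirchSwinnertonDyer.BirchSwinnertonDyer.Theorems.KatoDescentPotSupersingularReducibleKatoMemberNodes
import HarnessLib

/-!
# Route `KatoDescentTamePotSupersingular` (rung K8-t′, cell `bsd-potss`): the GLUE item
# `ReducibleKatoMemberOfHullInputsT` (stmt-BirchSwinnertonDyer-19661) of the split crux M
# `ReducibleKatoMember` (19196) — CLOSED from Kato's published inputs at his member

The planner's glued split of crux M (KT rev 13, plan g13 12:21Z; rkm g3 REALISATION-SPEC v5 §2):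
`ReducibleKatoMemberOfHullInputsT := PublishedInputIwasawaH1DataT → PublishedInputNewformKatoT →
PublishedInputMemberHullInputsT → ReducibleKatoMember`, the three children being the HELD by-name aliases
of the Literature facts `Kato2004.nonempty_iwasawaH1Data`, `ModularForms.exists_isNewformOf`,
`Kato2004.exists_memberHullInputs` (p439134).  The closer is the route-free node theorem
`Theorems.ReducibleKatoMemberOfInputs.katoMemberShaBoundOfReducible_of_memberHullInputs` (p446895; proof =
seat rkm g3's staged P3, re-homed by seat kmc g9): the three aliases unfold definitionally to the facts
and the route decl `ReducibleKatoMember` is the node `O6.KatoMemberShaBoundOfReducible` by name.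
UNCONDITIONAL as a theorem of the glue's exact type (its hypotheses ARE the cite-level inputs); BSD is not
advanced: M's non-CM rows remain "Kato's Euler-system bound at an additive prime with `E[p]` reducible",
now an explicitly cited transcription (flag `Kato-12.6-13.10-14.16(2)-member-reading-reducible`).
Seat `bsd-potss-kmc` generation 9 (filed on the planner's 12:21Z ask addressed to rkm's successor).

References: [Kato2004Asterisque] Thm. 12.4–12.6 (pp. 221–222), Lemma 13.10 (1) (p. 230), 13.14 (p. 234),
§14.14–Lemma 14.15 (pp. 243–244), Prop. 14.16 (2) (p. 244); [Wuthrich2014] Lemma 14.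
-/

set_option autoImplicit false
-- sibling precedent (`KatoDescentTamePotSupersingularAssembly.lean`): the directory name repeats the summit name
set_option linter.dupNamespace false

namespace Summit.BirchSwinnertonDyer.BirchSwinnertonDyer.Theorems

/-- **Glue item 19661 `ReducibleKatoMemberOfHullInputsT` (type = the route decl verbatim):**
`PublishedInputIwasawaH1DataT → PublishedInputNewformKatoT → PublishedInputMemberHullInputsT →
ReducibleKatoMember`, by `ReducibleKatoMemberOfInputs.katoMemberShaBoundOfReducible_of_memberHullInputs`
(Kato's member package ⟶ hull descent + count ⟶ T-X3K).  Nothing else assumed.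
[cite: Kato2004Asterisque, Thm. 12.6 (p. 222), §14.14 and Lemma 14.15 (pp. 243–244), Prop. 14.16 (2) (p. 244)]
[cite: Wuthrich2014, Lemma 14 (p. 396)] -/
theorem reducibleKatoMemberOfHullInputsT_proof :
    Summit.BirchSwinnertonDyer.BirchSwinnertonDyer.Theses.KatoDescentTamePotSupersingular.ReducibleKatoMemberOfHullInputsT :=
  fun h₁ h₂ h₃ => ReducibleKatoMemberOfInputs.katoMemberShaBoundOfReducible_of_memberHullInputs h₁ h₂ h₃

end Summit.BirchSwinnertonDyer.BirchSwinnertonDyer.Theorems
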